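import Mathlib.LinearAlgebra.Lagrange
import Mathlib.Analysis.Complex.ReImTopology
import Mathlib.Analysis.Complex.Convex
import Mathlib.Analysis.Calculus.MeanValue
import Mathlib.Analysis.Calculus.Deriv.Polynomial
import Literature.Analysis.Approximation.MarkovInequality
import HarnessLib

/-!
# Masser 1975, Lemmas 1.3 and 2.3 — coefficients of polynomials from their values

Support for the proof of Theorem II of D. W. Masser, *Elliptic Functions and Transcendence*,
LNM 437 (1975) (`Literature.NumberTheory.Transcendental.masser_ellipticPeriods`: the linear
independence of `1, ω₁, ω₂, η₁, η₂, 2πi` over `ℚ̄` without complex multiplication), following the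
book's own line (Ch. I–II). This file proves the two purely analytic lemmas that recover the
coefficients of a polynomial from upper bounds for its values on a well-distributed finite set:

* **Lemma 1.3** (p. 2): for `φ(z) = ∑_{λ ≤ L} p(λ) z^λ` and distinct nodes `σ₀, …, σ_L` with
  mutual distances `≥ δ` and `|σ_λ| ≤ S` (`S ≥ 1 ≥ δ`), `|p(λ)| ≤ (c S/δ)^L max_μ |φ(σ_μ)|`
  — `norm_coeff_le_of_eval_le` (with `c = 4`), its coefficient-array form
  `norm_le_of_sum_eval_le` and the equally spaced case `σ_μ = μ/L` (`norm_le_of_sum_grid_le`,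
  factor `(4L)^L`). Proof as printed: Lagrange interpolation (`Lagrange.eq_interpolate`), the
  denominators `∏_{μ ≠ λ} |σ_λ - σ_μ| ≥ δ^L` and the coefficients of `∏_{μ ≠ λ} (z - σ_μ)` bounded by
  `(1 + S)^L`.
* **Lemma 2.3** (pp. 18–20), in the form in which it is USED in the proof of the Main Lemma 2.4
  (p. 22: the points `(ξ₀, ξ₁, ξ₂)` lie within `2L⁻³` of every point `(r₀, r₁, r₂)/L³`,
  `|rᵢ| ≤ L³`, i.e. of every point of the real CUBE): if `𝒮 ⊂ ℂ³` contains a point within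
  `(21L²)⁻¹` (in each coordinate) of every real point of `[-1, 1]³`, then the coefficients of
  `φ(z) = ∑_{λ₁,λ₂,λ₃ ≤ L} p(λ) z₁^{λ₁} z₂^{λ₂} z₃^{λ₃}` satisfy
  `|p(λ)| ≤ 2 (4L)^{3L} sup_𝒮 |φ|` — `masser_lemma_2_3`. (The book states the hypothesis for the
  real points of the Euclidean unit BALL and the constant as `(c₁₀ L)^{c₁₁ L}`; its proof — and its
  only application — run through the cube `K' = [-1+δ, 1-δ]³`, which is what we formalise; cube
  density is the stronger hypothesis actually supplied on p. 22.) Proof as printed: with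
  `K = {|Re zᵢ| ≤ 1, |Im zᵢ| ≤ δ}` one shows `M(K) ≤ 2 sup_𝒮 |φ|` from A. A. Markov's inequality
  `sup |f'| ≤ L² sup |f|` on `[-1, 1]` applied in each variable (`(17)`–`(20)`; the complex-
  coefficient form `norm_derivative_eval_le_of_forall_norm_eval_le` is deduced here from the real
  one, `Literature.Analysis.Approximation.markov_inequality`, by a rotation) and the mean value
  inequality along the three coordinate segments (`(19)`), and then applies Lemma 1.3 in each
  variable at the nodes `λ/L ∈ K`.

Everything here is proved; no named facts. Lemma 2.1 (Wronskians), Lemma 2.2 and the Main Lemma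
2.4 (which need Theorem I) are not in this file.

## References

* D. W. Masser, *Elliptic Functions and Transcendence*, Lecture Notes in Math. 437, Springer 1975,
  Ch. I §1.2 Lemma 1.3 (p. 2); Ch. II §2.2 Lemma 2.3 (pp. 18–20), §2.3 (p. 22). [Masser1975]
* N. Korneichuk, *Exact Constants in Approximation Theory*, CUP 1991, Thm. 3.5.8 (Markov's
  inequality). [Korneichuk1991]
-/

noncomputable section

open Polynomial Finset Complex

namespace Literature.NumberTheory.Transcendental.Masser1975

/-! ### Lemma 1.3: coefficients from values at well-separated nodes -/

/-- The coefficients of `∏_{j ∈ s} (X - a_j)` with `|a_j| ≤ S` are bounded by `(1 + S)^{#s}`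
(induction on `s`: `coeff_k (P · (X - a)) = coeff_{k-1} P - a · coeff_k P`). [folklore] -/
theorem norm_coeff_prod_X_sub_C_le {ι : Type*} [DecidableEq ι] (s : Finset ι) (a : ι → ℂ)
    {S : ℝ} (hS : 0 ≤ S) (ha : ∀ j ∈ s, ‖a j‖ ≤ S) :
    ∀ k : ℕ, ‖(∏ j ∈ s, (X - C (a j))).coeff k‖ ≤ (1 + S) ^ s.card := by
  induction s using Finset.induction_on with
  | empty =>
    intro k
    simp only [prod_empty, card_empty, pow_zero, coeff_one]
    split_ifs <;> simp
  | insert i s hi ih =>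
    intro k
    have ha' : ∀ j ∈ s, ‖a j‖ ≤ S := fun j hj => ha j (mem_insert_of_mem hj)
    have hai : ‖a i‖ ≤ S := ha i (mem_insert_self i s)
    have ih' := ih ha'
    have h1S : (1 : ℝ) ≤ (1 + S) ^ s.card := one_le_pow₀ (by linarith)
    rw [prod_insert hi, card_insert_of_notMem hi, mul_comm, pow_succ]
    cases k with
    | zero =>
      simp only [mul_sub, coeff_sub, mul_coeff_zero, coeff_X_zero, mul_zero, coeff_C_zero,
        zero_sub, norm_neg, norm_mul]
      calc ‖(∏ j ∈ s, (X - C (a j))).coeff 0‖ * ‖a i‖ ≤ (1 + S) ^ s.card * S :=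
            mul_le_mul (ih' 0) hai (norm_nonneg _) (by positivity)
        _ ≤ (1 + S) ^ s.card * (1 + S) := by gcongr; linarith
    | succ k =>
      rw [coeff_mul_X_sub_C]
      calc ‖(∏ j ∈ s, (X - C (a j))).coeff k - (∏ j ∈ s, (X - C (a j))).coeff (k + 1) * a i‖
          ≤ ‖(∏ j ∈ s, (X - C (a j))).coeff k‖ +
              ‖(∏ j ∈ s, (X - C (a j))).coeff (k + 1)‖ * ‖a i‖ := by
            rw [← norm_mul]; exact norm_sub_le _ _
        _ ≤ (1 + S) ^ s.card + (1 + S) ^ s.card * S :=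
            add_le_add (ih' k) (mul_le_mul (ih' (k + 1)) hai (norm_nonneg _) (by positivity))
        _ = (1 + S) ^ s.card * (1 + S) := by ring

/-- `n + 1 ≤ 2^n` over `ℝ`. [folklore] -/
theorem nat_succ_le_two_pow (n : ℕ) : (n : ℝ) + 1 ≤ 2 ^ n := by
  induction n with
  | zero => norm_num
  | succ n ih =>
    have h1 : (1 : ℝ) ≤ 2 ^ n := one_le_pow₀ (by norm_num)
    push_cast
    calc (n : ℝ) + 1 + 1 ≤ 2 ^ n + 2 ^ n := add_le_add ih h1
      _ = 2 ^ (n + 1) := by ring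

/-- The coefficients of the Lagrange basis polynomial at `L + 1` nodes with mutual distances
`≥ δ > 0` and absolute values `≤ S` are at most `δ^{-L} (1 + S)^L`
(`ℓ_i = (∏_{j ≠ i} (σ_i - σ_j)⁻¹) · ∏_{j ≠ i} (X - σ_j)`). [cite: Masser1975, Lemma 1.3 (proof)] -/
theorem norm_coeff_lagrange_basis_le {L : ℕ} (σ : Fin (L + 1) → ℂ) {δ S : ℝ} (hδ : 0 < δ)
    (hS : 0 ≤ S) (hsep : ∀ i j, i ≠ j → δ ≤ ‖σ i - σ j‖) (hbd : ∀ i, ‖σ i‖ ≤ S)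
    (i : Fin (L + 1)) (k : ℕ) :
    ‖(Lagrange.basis Finset.univ σ i).coeff k‖ ≤ δ⁻¹ ^ L * (1 + S) ^ L := by
  classical
  have hcard : (univ.erase i).card = L := by
    rw [card_erase_of_mem (mem_univ i), card_univ, Fintype.card_fin, Nat.add_sub_cancel]
  have hbasis : Lagrange.basis univ σ i =
      C (∏ j ∈ univ.erase i, (σ i - σ j)⁻¹) * ∏ j ∈ univ.erase i, (X - C (σ j)) := by
    rw [Lagrange.basis, map_prod, ← prod_mul_distrib]
    rfl
  rw [hbasis, coeff_C_mul, norm_mul]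
  suffices h : ‖∏ j ∈ univ.erase i, (σ i - σ j)⁻¹‖ * ‖(∏ j ∈ univ.erase i, (X - C (σ j))).coeff k‖ ≤
      δ⁻¹ ^ (univ.erase i).card * (1 + S) ^ (univ.erase i).card by
    rwa [hcard] at h
  refine mul_le_mul ?_ ?_ (norm_nonneg _) (by positivity)
  · rw [norm_prod, ← prod_const]
    refine prod_le_prod (fun _ _ => norm_nonneg _) fun j hj => ?_
    rw [norm_inv]
    exact inv_anti₀ hδ (hsep i j (ne_of_mem_erase hj).symm)
  · exact norm_coeff_prod_X_sub_C_le _ _ hS (fun j _ => hbd j) k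

/-- **Masser's Lemma 1.3.** Let `φ(z) = ∑_{λ=0}^{L} p(λ) z^λ` and let `σ₀, …, σ_L` be complex
numbers with `min_{λ ≠ μ} |σ_λ - σ_μ| ≥ δ > 0` and `max |σ_λ| ≤ S`, `S ≥ 1`. Then for all `λ`,
`|p(λ)| ≤ (4S/δ)^L max_μ |φ(σ_μ)|` (the book: `(c₄ S/δ)^L` with an absolute constant `c₄`; proof by
the interpolation formula of Lagrange). Here `φ` is a polynomial of degree `≤ L` and `p(λ)` its
`λ`-th coefficient. [cite: Masser1975, Lemma 1.3] -/
theorem norm_coeff_le_of_eval_le {L : ℕ} (φ : ℂ[X]) (hφ : φ.natDegree ≤ L) (σ : Fin (L + 1) → ℂ)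
    {δ S M : ℝ} (hδ : 0 < δ) (hS : 1 ≤ S)
    (hsep : ∀ i j, i ≠ j → δ ≤ ‖σ i - σ j‖) (hbd : ∀ i, ‖σ i‖ ≤ S)
    (hM : ∀ i, ‖φ.eval (σ i)‖ ≤ M) (k : ℕ) :
    ‖φ.coeff k‖ ≤ (4 * S / δ) ^ L * M := by
  classical
  have hS0 : 0 < S := by linarith
  have M0 : 0 ≤ M := (norm_nonneg _).trans (hM 0)
  have hinj : Set.InjOn σ (univ : Finset (Fin (L + 1))) := by
    intro i _ j _ h
    by_contra hne
    have := hsep i j hne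
    rw [h, sub_self, norm_zero] at this
    exact absurd this (not_le.mpr hδ)
  have hdeg : φ.degree < (univ : Finset (Fin (L + 1))).card := by
    rw [card_univ, Fintype.card_fin]
    exact lt_of_le_of_lt degree_le_natDegree (WithBot.coe_lt_coe.mpr (Nat.lt_succ_of_le hφ))
  have hφeq := Lagrange.eq_interpolate hinj hdeg
  rw [hφeq, Lagrange.interpolate_apply, finsetSum_coeff]
  calc ‖∑ i, (C (φ.eval (σ i)) * Lagrange.basis univ σ i).coeff k‖
      ≤ ∑ i, ‖(C (φ.eval (σ i)) * Lagrange.basis univ σ i).coeff k‖ := norm_sum_le _ _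
    _ ≤ ∑ _i : Fin (L + 1), M * (δ⁻¹ ^ L * (1 + S) ^ L) := by
        refine sum_le_sum fun i _ => ?_
        rw [coeff_C_mul, norm_mul]
        exact mul_le_mul (hM i) (norm_coeff_lagrange_basis_le σ hδ hS0.le hsep hbd i k)
          (norm_nonneg _) M0
    _ = ((L : ℝ) + 1) * (δ⁻¹ ^ L * (1 + S) ^ L) * M := by
        rw [sum_const, card_univ, Fintype.card_fin]
        ring
    _ ≤ 2 ^ L * (δ⁻¹ ^ L * (2 * S) ^ L) * M := by
        have h1 := nat_succ_le_two_pow L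
        have h2 : 1 + S ≤ 2 * S := by linarith
        gcongr
    _ = (4 * S / δ) ^ L * M := by
        rw [← mul_pow, ← mul_pow, show (2 : ℝ) * (δ⁻¹ * (2 * S)) = 4 * S / δ by ring]

/-- Lemma 1.3 for a coefficient array `c` (only `c 0, …, c L` enter): if
`|∑_{j ≤ L} c_j σ_i^j| ≤ M` at `L + 1` nodes as in `norm_coeff_le_of_eval_le`, then
`|c_k| ≤ (4S/δ)^L M` for `k ≤ L`. [cite: Masser1975, Lemma 1.3] -/
theorem norm_le_of_sum_eval_le {L : ℕ} (c : ℕ → ℂ) (σ : Fin (L + 1) → ℂ) {δ S M : ℝ}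
    (hδ : 0 < δ) (hS : 1 ≤ S) (hsep : ∀ i j, i ≠ j → δ ≤ ‖σ i - σ j‖) (hbd : ∀ i, ‖σ i‖ ≤ S)
    (hM : ∀ i, ‖∑ j ∈ range (L + 1), c j * σ i ^ j‖ ≤ M) {k : ℕ} (hk : k ≤ L) :
    ‖c k‖ ≤ (4 * S / δ) ^ L * M := by
  set φ : ℂ[X] := ∑ j ∈ range (L + 1), C (c j) * X ^ j with hφdef
  have hφ : φ.natDegree ≤ L := by
    refine natDegree_sum_le_of_forall_le _ _ fun j hj => ?_
    exact (natDegree_C_mul_X_pow_le _ _).trans (Nat.lt_succ_iff.mp (mem_range.mp hj))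
  have hcoeff : φ.coeff k = c k := by
    simp only [hφdef, finsetSum_coeff, coeff_C_mul_X_pow]
    rw [sum_ite_eq (range (L + 1)) k c, if_pos (mem_range.mpr (Nat.lt_succ_of_le hk))]
  have heval : ∀ i, φ.eval (σ i) = ∑ j ∈ range (L + 1), c j * σ i ^ j := by
    intro i
    simp only [hφdef, eval_finsetSum, eval_mul, eval_C, eval_pow, eval_X]
  rw [← hcoeff]
  exact norm_coeff_le_of_eval_le φ hφ σ hδ hS hsep hbd (fun i => by rw [heval]; exact hM i) k

/-- Lemma 1.3 at the equally spaced nodes `σ_μ = μ/L` (`0 ≤ μ ≤ L`, `L ≥ 1`; `S = 1`,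
`δ = 1/L`): `|c_k| ≤ (4L)^L max_μ |∑_j c_j (μ/L)^j|` — the form used at the end of the proof of
Lemma 2.3 ("with, e.g., `σ_λ = λ/L`"). [cite: Masser1975, Lemma 2.3 (proof, last paragraph)] -/
theorem norm_le_of_sum_grid_le {L : ℕ} (hL : 1 ≤ L) (c : ℕ → ℂ) {M : ℝ}
    (hM : ∀ μ : ℕ, μ ≤ L → ‖∑ j ∈ range (L + 1), c j * ((μ : ℂ) / L) ^ j‖ ≤ M) {k : ℕ}
    (hk : k ≤ L) : ‖c k‖ ≤ (4 * L) ^ L * M := by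
  have hL0 : (0 : ℝ) < L := by exact_mod_cast hL
  set σ : Fin (L + 1) → ℂ := fun μ => (μ : ℕ) / (L : ℂ) with hσ
  have hsep : ∀ i j : Fin (L + 1), i ≠ j → 1 / (L : ℝ) ≤ ‖σ i - σ j‖ := by
    intro i j hij
    have hne : (i : ℕ) ≠ j := fun h => hij (Fin.ext h)
    have h1 : (1 : ℝ) ≤ |((i : ℕ) : ℝ) - ((j : ℕ) : ℝ)| := by
      rw [← Int.cast_natCast, ← Int.cast_natCast (j : ℕ), ← Int.cast_sub, ← Int.cast_abs,
        ← Int.cast_one, Int.cast_le]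
      exact Int.one_le_abs (sub_ne_zero.mpr (by exact_mod_cast hne))
    have : σ i - σ j = (((((i : ℕ) : ℝ) - ((j : ℕ) : ℝ)) / (L : ℝ) : ℝ) : ℂ) := by
      simp only [hσ]; push_cast; ring
    rw [this, Complex.norm_real, Real.norm_eq_abs, abs_div, abs_of_pos hL0]
    exact div_le_div_of_nonneg_right h1 hL0.le
  have hbd : ∀ i : Fin (L + 1), ‖σ i‖ ≤ 1 := by
    intro i
    have hi : ((i : ℕ) : ℝ) ≤ L := by exact_mod_cast Nat.lt_succ_iff.mp i.isLt
    have : σ i = ((((i : ℕ) : ℝ) / (L : ℝ) : ℝ) : ℂ) := by simp only [hσ]; push_cast; ring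
    rw [this, Complex.norm_real, Real.norm_eq_abs, abs_div, abs_of_pos hL0,
      abs_of_nonneg (Nat.cast_nonneg _), div_le_one hL0]
    exact hi
  have hM' : ∀ i : Fin (L + 1), ‖∑ j ∈ range (L + 1), c j * σ i ^ j‖ ≤ M := fun i =>
    hM i (Nat.lt_succ_iff.mp i.isLt)
  have h := norm_le_of_sum_eval_le c σ (one_div_pos.mpr hL0) le_rfl hsep hbd hM' hk
  calc ‖c k‖ ≤ (4 * 1 / (1 / (L : ℝ))) ^ L * M := h
    _ = (4 * L) ^ L * M := by rw [mul_one, div_div_eq_mul_div, div_one]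

/-! ### Markov's inequality for complex coefficients -/

/-- The real polynomial `∑ Re(a_k) X^k` attached to `f = ∑ a_k X^k ∈ ℂ[X]` (coefficientwise real
part; its values and derivatives at real points are the real parts of those of `f`). [folklore] -/
def rePoly (f : ℂ[X]) : ℝ[X] := ∑ i ∈ range (f.natDegree + 1), C (f.coeff i).re * X ^ i

/-- `coeff_k (rePoly f) = Re (coeff_k f)`. [folklore] -/
@[simp] theorem coeff_rePoly (f : ℂ[X]) (k : ℕ) : (rePoly f).coeff k = (f.coeff k).re := by
  simp only [rePoly, finsetSum_coeff, coeff_C_mul_X_pow]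
  rw [sum_ite_eq (range (f.natDegree + 1)) k]
  split_ifs with h
  · rfl
  · rw [mem_range, not_lt, Nat.succ_le_iff] at h
    rw [coeff_eq_zero_of_natDegree_lt h, Complex.zero_re]

/-- `deg (rePoly f) ≤ deg f`. [folklore] -/
theorem natDegree_rePoly_le (f : ℂ[X]) : (rePoly f).natDegree ≤ f.natDegree := by
  refine natDegree_sum_le_of_forall_le _ _ fun j hj => ?_
  exact (natDegree_C_mul_X_pow_le _ _).trans (Nat.lt_succ_iff.mp (mem_range.mp hj))

/-- `rePoly` commutes with derivation. [folklore] -/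
theorem derivative_rePoly (f : ℂ[X]) : derivative (rePoly f) = rePoly (derivative f) := by
  ext k
  rw [coeff_derivative, coeff_rePoly, coeff_rePoly, coeff_derivative]
  simp only [Complex.mul_re, Complex.add_re, Complex.natCast_re, Complex.one_re,
    Complex.add_im, Complex.natCast_im, Complex.one_im, add_zero, mul_zero, sub_zero]

/-- At a real point, `(rePoly f)(y) = Re f(y)`. [folklore] -/
theorem eval_rePoly (f : ℂ[X]) (y : ℝ) : (rePoly f).eval y = (f.eval (y : ℂ)).re := by
  have h1 : (rePoly f).eval y = ∑ i ∈ range (f.natDegree + 1), (f.coeff i).re * y ^ i := by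
    rw [eval_eq_sum_range' (Nat.lt_succ_of_le (natDegree_rePoly_le f))]
    simp only [coeff_rePoly]
  have h2 : f.eval (y : ℂ) = ∑ i ∈ range (f.natDegree + 1), f.coeff i * (y : ℂ) ^ i :=
    eval_eq_sum_range (y : ℂ)
  rw [h1, h2, Complex.re_sum]
  refine sum_congr rfl fun i _ => ?_
  rw [← Complex.ofReal_pow, Complex.mul_re, Complex.ofReal_re, Complex.ofReal_im, mul_zero,
    sub_zero]

/-- **Markov's inequality for polynomials with complex coefficients** (the form used in the proof
of Masser's Lemma 2.3, eq. (17): "it is easy to check by inspection that most proofs remain valid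
when `f(x)` is in `ℂ[x]`"): if `deg f ≤ n` and `|f(y)| ≤ M` for real `y ∈ [-1, 1]`, then
`|f'(x)| ≤ n² M` for real `x ∈ [-1, 1]`. Deduced from the real case
(`Literature.Analysis.Approximation.markov_inequality`) applied to `Re(u f)` for the unit complex
number `u` with `u f'(x) = |f'(x)|`. [cite: Masser1975, Lemma 2.3 (proof, (17))] -/
theorem norm_derivative_eval_le {n : ℕ} {f : ℂ[X]} (hf : f.natDegree ≤ n) {M : ℝ}
    (hM : ∀ y : ℝ, y ∈ Set.Icc (-1 : ℝ) 1 → ‖f.eval (y : ℂ)‖ ≤ M) {x : ℝ}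
    (hx : x ∈ Set.Icc (-1 : ℝ) 1) : ‖(derivative f).eval (x : ℂ)‖ ≤ (n : ℝ) ^ 2 * M := by
  set w : ℂ := (derivative f).eval (x : ℂ) with hw
  by_cases hw0 : w = 0
  · rw [hw0, norm_zero]
    exact mul_nonneg (by positivity) ((norm_nonneg _).trans (hM x hx))
  -- the unit `u = conj w / |w|` with `u w = |w|`
  set u : ℂ := (starRingEnd ℂ) w / (‖w‖ : ℂ) with hu
  have hwn : (‖w‖ : ℝ) ≠ 0 := norm_ne_zero_iff.mpr hw0
  have hu1 : ‖u‖ = 1 := by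
    rw [hu, norm_div, Complex.norm_conj, Complex.norm_real, Real.norm_eq_abs, abs_norm,
      div_self hwn]
  have huw : u * w = (‖w‖ : ℂ) := by
    rw [hu, div_mul_eq_mul_div, Complex.conj_mul', ← Complex.ofReal_pow, ← Complex.ofReal_div,
      pow_two, mul_div_assoc, div_self hwn, mul_one]
  set g : ℂ[X] := C u * f with hg
  have hgdeg : (rePoly g).degree ≤ n := by
    refine (degree_le_natDegree).trans (WithBot.coe_le_coe.mpr ?_)
    exact (natDegree_rePoly_le g).trans ((natDegree_C_mul_le _ _).trans hf)
  have hgM : ∀ y ∈ Set.Icc (-1 : ℝ) 1, |(rePoly g).eval y| ≤ M := by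
    intro y hy
    rw [eval_rePoly, hg, eval_mul, eval_C]
    refine (Complex.abs_re_le_norm _).trans ?_
    rw [norm_mul, hu1, one_mul]
    exact hM y hy
  have hmk := Literature.Analysis.Approximation.markov_inequality hgdeg hgM hx
  rw [derivative_rePoly, eval_rePoly, hg, derivative_C_mul, eval_mul, eval_C, ← hw, huw,
    Complex.ofReal_re, abs_norm] at hmk
  exact hmk

/-- Markov's inequality on the horizontal segment `{x + iη : -1 ≤ x ≤ 1}`: if `deg f ≤ n` and
`|f(y + iη)| ≤ M` for `y ∈ [-1, 1]`, then `|f'(x + iη)| ≤ n² M` for `x ∈ [-1, 1]` (translate by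
`iη`). This is inequality (20) of the proof of Lemma 2.3. [cite: Masser1975, Lemma 2.3 (proof, (20))] -/
theorem norm_derivative_eval_le_of_line {n : ℕ} {f : ℂ[X]} (hf : f.natDegree ≤ n) (η : ℝ)
    {M : ℝ} (hM : ∀ y : ℝ, y ∈ Set.Icc (-1 : ℝ) 1 → ‖f.eval ((y : ℂ) + η * I)‖ ≤ M) {x : ℝ}
    (hx : x ∈ Set.Icc (-1 : ℝ) 1) :
    ‖(derivative f).eval ((x : ℂ) + η * I)‖ ≤ (n : ℝ) ^ 2 * M := by
  set g : ℂ[X] := f.comp (X + C ((η : ℂ) * I)) with hg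
  have hgdeg : g.natDegree ≤ n := by
    refine natDegree_comp_le.trans ?_
    rw [natDegree_X_add_C, mul_one]
    exact hf
  have hgeval : ∀ y : ℝ, g.eval (y : ℂ) = f.eval ((y : ℂ) + η * I) := by
    intro y
    simp only [hg, eval_comp, eval_add, eval_X, eval_C]
  have hgM : ∀ y : ℝ, y ∈ Set.Icc (-1 : ℝ) 1 → ‖g.eval (y : ℂ)‖ ≤ M := fun y hy => by
    rw [hgeval]; exact hM y hy
  have h := norm_derivative_eval_le hgdeg hgM hx
  have hderiv : (derivative g).eval (x : ℂ) = (derivative f).eval ((x : ℂ) + η * I) := by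
    simp only [hg, derivative_comp, derivative_add, derivative_X, derivative_C, add_zero,
      one_mul, eval_comp, eval_add, eval_X, eval_C]
  rwa [hderiv] at h

/-! ### Lemma 2.3: three variables, values near the real cube -/

/-- The polynomial `φ(z₁, z₂, z₃) = ∑_{λ₁,λ₂,λ₃=0}^{L} p(λ₁, λ₂, λ₃) z₁^{λ₁} z₂^{λ₂} z₃^{λ₃}` of
Lemma 2.3, as a function of its coefficient array (entries with an index `> L` do not enter),
written with the sums nested `z₃` innermost. [cite: Masser1975, Lemma 2.3] -/
def triEval (L : ℕ) (p : ℕ → ℕ → ℕ → ℂ) (z₁ z₂ z₃ : ℂ) : ℂ :=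
  ∑ i ∈ range (L + 1), (∑ j ∈ range (L + 1), (∑ l ∈ range (L + 1), p i j l * z₃ ^ l) * z₂ ^ j) *
    z₁ ^ i

/-- `φ(·, z₂, z₃)` as a polynomial in `z₁`. [folklore] -/
def secPoly₁ (L : ℕ) (p : ℕ → ℕ → ℕ → ℂ) (z₂ z₃ : ℂ) : ℂ[X] :=
  ∑ i ∈ range (L + 1), C (∑ j ∈ range (L + 1), (∑ l ∈ range (L + 1), p i j l * z₃ ^ l) * z₂ ^ j) *
    X ^ i

/-- `φ(z₁, ·, z₃)` as a polynomial in `z₂`. [folklore] -/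
def secPoly₂ (L : ℕ) (p : ℕ → ℕ → ℕ → ℂ) (z₁ z₃ : ℂ) : ℂ[X] :=
  ∑ j ∈ range (L + 1), C (∑ i ∈ range (L + 1), (∑ l ∈ range (L + 1), p i j l * z₃ ^ l) * z₁ ^ i) *
    X ^ j

/-- `φ(z₁, z₂, ·)` as a polynomial in `z₃`. [folklore] -/
def secPoly₃ (L : ℕ) (p : ℕ → ℕ → ℕ → ℂ) (z₁ z₂ : ℂ) : ℂ[X] :=
  ∑ l ∈ range (L + 1), C (∑ i ∈ range (L + 1), ∑ j ∈ range (L + 1), p i j l * z₂ ^ j * z₁ ^ i) *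
    X ^ l

section triEval

variable (L : ℕ) (p : ℕ → ℕ → ℕ → ℂ)

/-- `secPoly₁` evaluates to `φ(t, z₂, z₃)`. [folklore] -/
theorem eval_secPoly₁ (z₂ z₃ t : ℂ) : (secPoly₁ L p z₂ z₃).eval t = triEval L p t z₂ z₃ := by
  simp only [secPoly₁, triEval, eval_finsetSum, eval_mul, eval_C, eval_pow, eval_X]

/-- `secPoly₂` evaluates to `φ(z₁, u, z₃)` (interchange of the two outer sums). [folklore] -/
theorem eval_secPoly₂ (z₁ z₃ u : ℂ) : (secPoly₂ L p z₁ z₃).eval u = triEval L p z₁ u z₃ := by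
  simp only [secPoly₂, triEval, eval_finsetSum, eval_mul, eval_C, eval_pow, eval_X, sum_mul]
  rw [sum_comm]
  refine sum_congr rfl fun i _ => sum_congr rfl fun j _ => sum_congr rfl fun l _ => ?_
  ring

/-- `secPoly₃` evaluates to `φ(z₁, z₂, v)` (the innermost sum moved outside). [folklore] -/
theorem eval_secPoly₃ (z₁ z₂ v : ℂ) : (secPoly₃ L p z₁ z₂).eval v = triEval L p z₁ z₂ v := by
  simp only [secPoly₃, triEval, eval_finsetSum, eval_mul, eval_C, eval_pow, eval_X, sum_mul]
  rw [sum_comm]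
  refine sum_congr rfl fun i _ => ?_
  rw [sum_comm]
  refine sum_congr rfl fun j _ => sum_congr rfl fun l _ => ?_
  ring

/-- `deg secPoly₁ ≤ L`. [folklore] -/
theorem natDegree_secPoly₁_le (z₂ z₃ : ℂ) : (secPoly₁ L p z₂ z₃).natDegree ≤ L := by
  refine natDegree_sum_le_of_forall_le _ _ fun j hj => ?_
  exact (natDegree_C_mul_X_pow_le _ _).trans (Nat.lt_succ_iff.mp (mem_range.mp hj))

/-- `deg secPoly₂ ≤ L`. [folklore] -/
theorem natDegree_secPoly₂_le (z₁ z₃ : ℂ) : (secPoly₂ L p z₁ z₃).natDegree ≤ L := by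
  refine natDegree_sum_le_of_forall_le _ _ fun j hj => ?_
  exact (natDegree_C_mul_X_pow_le _ _).trans (Nat.lt_succ_iff.mp (mem_range.mp hj))

/-- `deg secPoly₃ ≤ L`. [folklore] -/
theorem natDegree_secPoly₃_le (z₁ z₂ : ℂ) : (secPoly₃ L p z₁ z₂).natDegree ≤ L := by
  refine natDegree_sum_le_of_forall_le _ _ fun j hj => ?_
  exact (natDegree_C_mul_X_pow_le _ _).trans (Nat.lt_succ_iff.mp (mem_range.mp hj))

/-- `φ` is continuous on `ℂ³`. [folklore] -/
theorem continuous_triEval : Continuous fun z : ℂ × ℂ × ℂ => triEval L p z.1 z.2.1 z.2.2 := by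
  unfold triEval
  fun_prop

end triEval

/-- The mean value inequality in one variable on the strip-rectangle
`K₁ = {|Re s| ≤ 1, |Im s| ≤ δ}` (eqs. (19)–(20) of the proof of Lemma 2.3): if `deg Q ≤ L` and
`|Q| ≤ B` on `K₁`, then `|Q(t) - Q(t')| ≤ L² B |t - t'|` for `t, t' ∈ K₁` — Markov's inequality on
each horizontal segment bounds `|Q'| ≤ L² B` on the convex set `K₁`.
[cite: Masser1975, Lemma 2.3 (proof, (19)–(20))] -/
theorem norm_eval_sub_eval_le_of_strip {L : ℕ} {Q : ℂ[X]} (hQ : Q.natDegree ≤ L) {δ B : ℝ}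
    (hB : ∀ s : ℂ, |s.re| ≤ 1 → |s.im| ≤ δ → ‖Q.eval s‖ ≤ B) {t t' : ℂ}
    (ht : |t.re| ≤ 1 ∧ |t.im| ≤ δ) (ht' : |t'.re| ≤ 1 ∧ |t'.im| ≤ δ) :
    ‖Q.eval t - Q.eval t'‖ ≤ (L : ℝ) ^ 2 * B * ‖t - t'‖ := by
  set K₁ : Set ℂ := Set.Icc (-1 : ℝ) 1 ×ℂ Set.Icc (-δ) δ with hK₁
  have hmem : ∀ s : ℂ, s ∈ K₁ ↔ |s.re| ≤ 1 ∧ |s.im| ≤ δ := by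
    intro s
    rw [hK₁, mem_reProdIm, Set.mem_Icc, Set.mem_Icc, abs_le, abs_le]
  have hconv : Convex ℝ K₁ := by
    have h := Complex.convexHull_reProdIm (Set.Icc (-1 : ℝ) 1) (Set.Icc (-δ) δ)
    rw [(convex_Icc (-1 : ℝ) 1).convexHull_eq, (convex_Icc (-δ) δ).convexHull_eq] at h
    rw [hK₁, ← h]
    exact convex_convexHull ℝ _
  have hderiv : ∀ s ∈ K₁, ‖deriv (fun x => Q.eval x) s‖ ≤ (L : ℝ) ^ 2 * B := by
    intro s hs
    rw [Polynomial.deriv]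
    have hs' := (hmem s).mp hs
    have hline : ∀ y : ℝ, y ∈ Set.Icc (-1 : ℝ) 1 → ‖Q.eval ((y : ℂ) + s.im * I)‖ ≤ B := by
      intro y hy
      refine hB _ ?_ ?_
      · simpa [abs_le] using hy
      · simpa using hs'.2
    have hx : s.re ∈ Set.Icc (-1 : ℝ) 1 := by simpa [abs_le] using hs'.1
    have key := norm_derivative_eval_le_of_line hQ s.im hline hx
    rwa [Complex.re_add_im] at key
  have h := hconv.norm_image_sub_le_of_norm_deriv_le (fun s _ => Q.differentiableAt) hderiv
    ((hmem t').mpr ht') ((hmem t).mpr ht)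
  exact h

/-- Clamping a real part to `[-(1-δ), 1-δ]`: for `ζ` with `|Re ζ| ≤ 1`, `|Im ζ| ≤ δ` there is a
real `x`, `|x| ≤ 1`, such that every `s` within `δ` of `x` satisfies `|Re s| ≤ 1`, `|Im s| ≤ δ`
and `|ζ - s| ≤ 3δ` (the points `ζ'`, `σ` of the proof of Lemma 2.3, eq. (18)).
[cite: Masser1975, Lemma 2.3 (proof, (18))] -/
theorem exists_clamp {δ : ℝ} (hδ0 : 0 ≤ δ) (hδ1 : δ ≤ 1) {ζ : ℂ} (hζ : |ζ.re| ≤ 1 ∧ |ζ.im| ≤ δ) :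
    ∃ x : ℝ, |x| ≤ 1 ∧ ∀ s : ℂ, ‖s - x‖ ≤ δ →
      (|s.re| ≤ 1 ∧ |s.im| ≤ δ) ∧ ‖ζ - s‖ ≤ 3 * δ := by
  set c : ℝ := 1 - δ with hc
  have hc0 : 0 ≤ c := by linarith
  set x : ℝ := max (-c) (min c ζ.re) with hx
  have hxc : |x| ≤ c := by
    rw [abs_le]
    exact ⟨le_max_left _ _, max_le (by linarith) (min_le_left _ _)⟩
  have hxζ : |ζ.re - x| ≤ δ := by
    have hr := hζ.1
    rw [abs_le] at hr ⊢
    rcases le_total c ζ.re with h | h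
    · rw [hx, min_eq_left h, max_eq_right (by linarith : -c ≤ c)]
      constructor <;> linarith
    · rw [hx, min_eq_right h]
      rcases le_total (-c) ζ.re with h' | h'
      · rw [max_eq_right h']
        constructor <;> linarith
      · rw [max_eq_left h']
        constructor <;> linarith
  refine ⟨x, hxc.trans (by linarith), fun s hs => ⟨⟨?_, ?_⟩, ?_⟩⟩
  · have h1 : |(s - x).re| ≤ ‖s - x‖ := Complex.abs_re_le_norm _
    have h2 : (s - x).re = s.re - x := by simp
    rw [h2] at h1
    have h3 : |s.re| ≤ |s.re - x| + |x| := by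
      calc |s.re| = |s.re - x + x| := by ring_nf
        _ ≤ |s.re - x| + |x| := abs_add_le _ _
    linarith
  · have h1 : |(s - x).im| ≤ ‖s - x‖ := Complex.abs_im_le_norm _
    have h2 : (s - x).im = s.im := by simp
    rw [h2] at h1
    linarith
  · have h1 : ‖ζ - (x : ℂ)‖ ≤ |(ζ - x).re| + |(ζ - x).im| := Complex.norm_le_abs_re_add_abs_im _
    have h2 : (ζ - x).re = ζ.re - x := by simp
    have h3 : (ζ - x).im = ζ.im := by simp
    rw [h2, h3] at h1
    calc ‖ζ - s‖ = ‖(ζ - x) + (x - s)‖ := by ring_nf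
      _ ≤ ‖ζ - (x : ℂ)‖ + ‖(x : ℂ) - s‖ := norm_add_le _ _
      _ ≤ (δ + δ) + δ := by
          refine add_le_add (h1.trans (add_le_add hxζ hζ.2)) ?_
          rwa [norm_sub_rev]
      _ = 3 * δ := by ring

/-- **Masser's Lemma 2.3** (cube form). For an integer `L ≥ 1` let `𝒮 ⊂ ℂ³` contain, for every
real point `(x₁, x₂, x₃)` of the cube `|xᵢ| ≤ 1`, a point within `(21L²)⁻¹` of it in each
coordinate, and let `φ(z) = ∑_{λ₁,λ₂,λ₃=0}^{L} p(λ₁,λ₂,λ₃) z₁^{λ₁} z₂^{λ₂} z₃^{λ₃}` (`triEval`).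
Then for all `λ₁, λ₂, λ₃ ≤ L`, `|p(λ₁,λ₂,λ₃)| ≤ 2 (4L)^{3L} sup_{z ∈ 𝒮} |φ(z)|`. The book states the
density hypothesis for the real points `ℬ_R` of the unit ball and the bound as
`(c₁₀ L)^{c₁₁ L} sup_𝒮 |φ|`; the printed proof (pp. 19–20: `K' = {|Re zᵢ| ≤ 1-δ, Im zᵢ = 0}`,
`K = {|Re zᵢ| ≤ 1, |Im zᵢ| ≤ δ}`, `δ = (21L²)⁻¹`, `M(K) ≤ 2M(𝒮 ∩ K)` by Markov's inequality and
(19), then Lemma 1.3 in each variable at `σ_λ = λ/L`) uses exactly the cube, and so does the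
lemma's application in the proof of Lemma 2.4 (p. 22). [cite: Masser1975, Lemma 2.3] -/
theorem masser_lemma_2_3 {L : ℕ} (hL : 1 ≤ L) (p : ℕ → ℕ → ℕ → ℂ) (𝒮 : Set (ℂ × ℂ × ℂ))
    {M : ℝ}
    (h𝒮 : ∀ x₁ x₂ x₃ : ℝ, |x₁| ≤ 1 → |x₂| ≤ 1 → |x₃| ≤ 1 → ∃ s ∈ 𝒮,
      ‖s.1 - x₁‖ ≤ (21 * (L : ℝ) ^ 2)⁻¹ ∧ ‖s.2.1 - x₂‖ ≤ (21 * (L : ℝ) ^ 2)⁻¹ ∧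
        ‖s.2.2 - x₃‖ ≤ (21 * (L : ℝ) ^ 2)⁻¹)
    (hM : ∀ s ∈ 𝒮, ‖triEval L p s.1 s.2.1 s.2.2‖ ≤ M) {i j l : ℕ} (hi : i ≤ L) (hj : j ≤ L)
    (hl : l ≤ L) : ‖p i j l‖ ≤ 2 * (4 * L) ^ (3 * L) * M := by
  -- the constants
  set δ : ℝ := (21 * (L : ℝ) ^ 2)⁻¹ with hδ
  have hL1 : (1 : ℝ) ≤ L := by exact_mod_cast hL
  have hL0 : (0 : ℝ) < L := by linarith
  have hδ0 : 0 < δ := by positivity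
  have hδ1 : δ ≤ 1 := by
    rw [hδ]
    exact inv_le_one_of_one_le₀ (by nlinarith)
  have hδL : (L : ℝ) ^ 2 * (9 * δ) ≤ 1 / 2 := by
    rw [hδ, ← div_eq_mul_inv, ← mul_div_assoc, div_le_iff₀ (by positivity)]
    nlinarith
  -- the box `K = K₁³`, `K₁ = {|Re| ≤ 1, |Im| ≤ δ}`, and the maximum `MK` of `|φ|` on it
  set K₁ : Set ℂ := Set.Icc (-1 : ℝ) 1 ×ℂ Set.Icc (-δ) δ with hK₁
  have hmem : ∀ s : ℂ, s ∈ K₁ ↔ |s.re| ≤ 1 ∧ |s.im| ≤ δ := by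
    intro s
    rw [hK₁, mem_reProdIm, Set.mem_Icc, Set.mem_Icc, abs_le, abs_le]
  have hK₁cpt : IsCompact K₁ :=
    Metric.isCompact_of_isClosed_isBounded (IsClosed.reProdIm isClosed_Icc isClosed_Icc)
      (Bornology.IsBounded.reProdIm (Metric.isBounded_Icc _ _) (Metric.isBounded_Icc _ _))
  have hreal : ∀ x : ℝ, |x| ≤ 1 → (x : ℂ) ∈ K₁ := fun x hx =>
    (hmem x).mpr ⟨by simpa using hx, by simp [hδ0.le]⟩
  set K : Set (ℂ × ℂ × ℂ) := K₁ ×ˢ K₁ ×ˢ K₁ with hK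
  have hKcpt : IsCompact K := hK₁cpt.prod (hK₁cpt.prod hK₁cpt)
  have hKne : K.Nonempty := ⟨((0 : ℝ), (0 : ℝ), (0 : ℝ)),
    Set.mk_mem_prod (hreal 0 (by simp)) (Set.mk_mem_prod (hreal 0 (by simp)) (hreal 0 (by simp)))⟩
  set φ : ℂ × ℂ × ℂ → ℂ := fun z => triEval L p z.1 z.2.1 z.2.2 with hφ
  have hφcont : Continuous fun z => ‖φ z‖ := (continuous_triEval L p).norm
  obtain ⟨ζ, hζK, hζmax⟩ := hKcpt.exists_isMaxOn hKne hφcont.continuousOn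
  set MK : ℝ := ‖φ ζ‖ with hMK
  have hMKle : ∀ z ∈ K, ‖φ z‖ ≤ MK := fun z hz => hζmax hz
  have hζ1 : |ζ.1.re| ≤ 1 ∧ |ζ.1.im| ≤ δ := (hmem _).mp hζK.1
  have hζ2 : |ζ.2.1.re| ≤ 1 ∧ |ζ.2.1.im| ≤ δ := (hmem _).mp hζK.2.1
  have hζ3 : |ζ.2.2.re| ≤ 1 ∧ |ζ.2.2.im| ≤ δ := (hmem _).mp hζK.2.2
  -- the points `ζ' ∈ K'` and `σ ∈ 𝒮 ∩ K` close to `ζ`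
  obtain ⟨x₁, hx₁, hx₁'⟩ := exists_clamp hδ0.le hδ1 hζ1
  obtain ⟨x₂, hx₂, hx₂'⟩ := exists_clamp hδ0.le hδ1 hζ2
  obtain ⟨x₃, hx₃, hx₃'⟩ := exists_clamp hδ0.le hδ1 hζ3
  obtain ⟨σ, hσ𝒮, hσ1, hσ2, hσ3⟩ := h𝒮 x₁ x₂ x₃ hx₁ hx₂ hx₃
  obtain ⟨hσ1K, hd1⟩ := hx₁' σ.1 hσ1
  obtain ⟨hσ2K, hd2⟩ := hx₂' σ.2.1 hσ2
  obtain ⟨hσ3K, hd3⟩ := hx₃' σ.2.2 hσ3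
  -- `|φ(ζ) - φ(σ)| ≤ 9 δ L² MK` by the three coordinate steps (19)
  have hMK0 : 0 ≤ MK := norm_nonneg _
  have step1 : ‖triEval L p ζ.1 ζ.2.1 ζ.2.2 - triEval L p σ.1 ζ.2.1 ζ.2.2‖ ≤
      (L : ℝ) ^ 2 * MK * (3 * δ) := by
    rw [← eval_secPoly₁, ← eval_secPoly₁]
    refine (norm_eval_sub_eval_le_of_strip (natDegree_secPoly₁_le L p _ _) (B := MK)
      (fun s hs1 hs2 => ?_) hζ1 hσ1K).trans (by gcongr)
    rw [eval_secPoly₁]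
    exact hMKle (s, ζ.2.1, ζ.2.2) (Set.mk_mem_prod ((hmem s).mpr ⟨hs1, hs2⟩) hζK.2)
  have step2 : ‖triEval L p σ.1 ζ.2.1 ζ.2.2 - triEval L p σ.1 σ.2.1 ζ.2.2‖ ≤
      (L : ℝ) ^ 2 * MK * (3 * δ) := by
    rw [← eval_secPoly₂, ← eval_secPoly₂]
    refine (norm_eval_sub_eval_le_of_strip (natDegree_secPoly₂_le L p _ _) (B := MK)
      (fun s hs1 hs2 => ?_) hζ2 hσ2K).trans (by gcongr)
    rw [eval_secPoly₂]
    exact hMKle (σ.1, s, ζ.2.2) (Set.mk_mem_prod ((hmem _).mpr hσ1K)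
      (Set.mk_mem_prod ((hmem s).mpr ⟨hs1, hs2⟩) hζK.2.2))
  have step3 : ‖triEval L p σ.1 σ.2.1 ζ.2.2 - triEval L p σ.1 σ.2.1 σ.2.2‖ ≤
      (L : ℝ) ^ 2 * MK * (3 * δ) := by
    rw [← eval_secPoly₃, ← eval_secPoly₃]
    refine (norm_eval_sub_eval_le_of_strip (natDegree_secPoly₃_le L p _ _) (B := MK)
      (fun s hs1 hs2 => ?_) hζ3 hσ3K).trans (by gcongr)
    rw [eval_secPoly₃]
    exact hMKle (σ.1, σ.2.1, s) (Set.mk_mem_prod ((hmem _).mpr hσ1K)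
      (Set.mk_mem_prod ((hmem _).mpr hσ2K) ((hmem s).mpr ⟨hs1, hs2⟩)))
  have hdiff : ‖φ ζ - φ σ‖ ≤ (L : ℝ) ^ 2 * (9 * δ) * MK := by
    have : φ ζ - φ σ = (triEval L p ζ.1 ζ.2.1 ζ.2.2 - triEval L p σ.1 ζ.2.1 ζ.2.2) +
        ((triEval L p σ.1 ζ.2.1 ζ.2.2 - triEval L p σ.1 σ.2.1 ζ.2.2) +
        (triEval L p σ.1 σ.2.1 ζ.2.2 - triEval L p σ.1 σ.2.1 σ.2.2)) := by
      simp only [hφ]; ring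
    rw [this]
    refine (norm_add_le _ _).trans ((add_le_add step1 ((norm_add_le _ _).trans
      (add_le_add step2 step3))).trans (le_of_eq (by ring)))
  -- hence `MK ≤ 2 M`
  have hM0 : 0 ≤ M := (norm_nonneg _).trans (hM σ hσ𝒮)
  have hMK2 : MK ≤ 2 * M := by
    have h1 : MK ≤ ‖φ σ‖ + ‖φ ζ - φ σ‖ := norm_le_insert' (φ ζ) (φ σ)
    have h2 : ‖φ σ‖ ≤ M := hM σ hσ𝒮
    have h3 : ‖φ ζ - φ σ‖ ≤ 1 / 2 * MK :=
      hdiff.trans (mul_le_mul_of_nonneg_right hδL hMK0)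
    linarith
  -- values at the nodes `(μ₁/L, μ₂/L, μ₃/L) ∈ K`
  have hnode : ∀ μ : ℕ, μ ≤ L → ((μ : ℂ) / L) ∈ K₁ := by
    intro μ hμ
    have hμ' : (μ : ℝ) ≤ L := by exact_mod_cast hμ
    have : ((μ : ℂ) / L) = (((μ : ℝ) / L : ℝ) : ℂ) := by push_cast; ring
    rw [this]
    refine hreal _ ?_
    rw [abs_div, abs_of_nonneg (Nat.cast_nonneg _), abs_of_pos hL0, div_le_one hL0]
    exact hμ'
  have hgrid : ∀ μ₁ μ₂ μ₃ : ℕ, μ₁ ≤ L → μ₂ ≤ L → μ₃ ≤ L →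
      ‖triEval L p ((μ₁ : ℂ) / L) ((μ₂ : ℂ) / L) ((μ₃ : ℂ) / L)‖ ≤ 2 * M := by
    intro μ₁ μ₂ μ₃ h₁ h₂ h₃
    exact (hMKle (((μ₁ : ℂ) / L), ((μ₂ : ℂ) / L), ((μ₃ : ℂ) / L))
      (Set.mk_mem_prod (hnode μ₁ h₁) (Set.mk_mem_prod (hnode μ₂ h₂) (hnode μ₃ h₃)))).trans hMK2
  -- Lemma 1.3 in `z₁`, then `z₂`, then `z₃`
  have hpos : (0 : ℝ) ≤ (4 * L) ^ L := by positivity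
  have lev1 : ∀ μ₂ μ₃ : ℕ, μ₂ ≤ L → μ₃ ≤ L → ∀ i', i' ≤ L →
      ‖∑ j' ∈ range (L + 1), (∑ l' ∈ range (L + 1), p i' j' l' * ((μ₃ : ℂ) / L) ^ l') *
        ((μ₂ : ℂ) / L) ^ j'‖ ≤ (4 * L) ^ L * (2 * M) := by
    intro μ₂ μ₃ h₂ h₃ i' hi'
    refine norm_le_of_sum_grid_le hL (fun i' => ∑ j' ∈ range (L + 1),
      (∑ l' ∈ range (L + 1), p i' j' l' * ((μ₃ : ℂ) / L) ^ l') * ((μ₂ : ℂ) / L) ^ j')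
      (fun μ hμ => ?_) hi'
    exact hgrid μ μ₂ μ₃ hμ h₂ h₃
  have lev2 : ∀ μ₃ : ℕ, μ₃ ≤ L → ∀ i' j', i' ≤ L → j' ≤ L →
      ‖∑ l' ∈ range (L + 1), p i' j' l' * ((μ₃ : ℂ) / L) ^ l'‖ ≤
        (4 * L) ^ L * ((4 * L) ^ L * (2 * M)) := by
    intro μ₃ h₃ i' j' hi' hj'
    exact norm_le_of_sum_grid_le hL (fun j' => ∑ l' ∈ range (L + 1),
      p i' j' l' * ((μ₃ : ℂ) / L) ^ l') (fun μ hμ => lev1 μ μ₃ hμ h₃ i' hi') hj'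
  have lev3 : ‖p i j l‖ ≤ (4 * L) ^ L * ((4 * L) ^ L * ((4 * L) ^ L * (2 * M))) :=
    norm_le_of_sum_grid_le hL (fun l' => p i j l') (fun μ hμ => lev2 μ hμ i j hi hj) hl
  calc ‖p i j l‖ ≤ (4 * L) ^ L * ((4 * L) ^ L * ((4 * L) ^ L * (2 * M))) := lev3
    _ = 2 * (4 * L) ^ (3 * L) * M := by ring

end Literature.NumberTheory.Transcendental.Masser1975
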